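import Literature.Barriers.CriticalPhenomena.LongRangeTransition
import Literature.Barriers.CriticalPhenomena.LongRangeDiscontinuityDischarge
import HarnessLib

/-!
# The `1/|x-y|²` family: Aizenman–Newman's phase diagram, unconditionally

Proofs-only companion of `Literature.Barriers.CriticalPhenomena.LongRangeDiscontinuity`: the
discharge `AizenmanNewman1986_family_holds` of the named fact `AizenmanNewman1986_family`
(Aizenman–Newman 1986, pp. 614–615, (a)–(b) for the family (1.7): for `β > 1` there is
`p_c(β) ∈ [0, 1)` with `M = 0` below and `M ≥ β^{-1/2}` above), assembled by
`AizenmanNewman1986_family_of` (`LongRangeDiscontinuityProofs.lean`) from its two published inputs,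
both now theorems of the tree:

* `NewmanSchulman1986_transition_holds` (`LongRangeTransition.lean`; Duminil-Copin–Garban–Tassion
  2024, Thm. 1(i));
* `LongRangeDiscontinuity_holds` (`LongRangeDiscontinuityDischarge.lean`; Aizenman–Newman 1986,
  Prop. 1.1, after Duminil-Copin–Garban–Tassion 2024, Thm. 1(ii)).

(The family form of the dichotomy, `DuminilCopinGarbanTassion2024_dichotomy_holds`, and the
conditional `AizenmanNewman1986_family_of_transition` are in `LongRangeDiscontinuityDischarge.lean`;
this file supplies the transition and closes the fact.)

## References

* M. Aizenman, C. M. Newman, *Discontinuity of the percolation density in one-dimensional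
  `1/|x-y|²` percolation models*, Comm. Math. Phys. 107 (1986) 611–647: Prop. 1.1, p. 614–615.
* H. Duminil-Copin, C. Garban, V. Tassion, *Long-range models in 1D revisited*, AIHP 60 (2024)
  232–241, arXiv:2011.04642: Thm. 1.
-/

noncomputable section

namespace Literature.Barriers.CriticalPhenomena

/-- **DISCHARGE of `AizenmanNewman1986_family`**: for every `β > 1` the `1/|x|²` family (1.7)
has a threshold `p_c ∈ [0, 1)` below which the percolation density vanishes and above which
(for `p < 1`) it is at least `β^{-1/2}` — Newman–Schulman's transition plus Aizenman–Newman's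
Prop. 1.1. [cite: AizenmanNewman1986, §1 (iii) pp. 614–615 ((1.7), (a)–(b))] -/
theorem AizenmanNewman1986_family_holds : AizenmanNewman1986_family :=
  AizenmanNewman1986_family_of NewmanSchulman1986_transition_holds LongRangeDiscontinuity_holds

end Literature.Barriers.CriticalPhenomena

end
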